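import Summits.CriticalPhenomena.PercolationContinuityZ3.Theorems.PercNearOneGluingNoHeavyLowerTailSahiE4UnionPartialLattice
import Summits.CriticalPhenomena.PercolationContinuityZ3.Theorems.PercNearOneGluingNoHeavyLowerTailSahiE3ProductRowUnionLattice
import Summits.CriticalPhenomena.PercolationContinuityZ3.Theorems.PercNearOneGluingNoHeavyLowerTailSahiE3UnionTensorLattice
import Mathlib.Tactic.LinearCombination
import Mathlib.Tactic.FinCases
import HarnessLib

/-!
# `NoHeavyLowerTail` (crux stmt-CriticalPhenomena-4575), Sahi programme P4, ORDER 4: the PAIR-BLOCK STEP — OR-ing an independent positively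
# associated pair into two members of a quadruple preserves the class `H₄⁺ = {E₃ of the four sub-triples, E₃ of the six product triples, E₄} ≥ 0`

Support file (cell `prim-l12`, seat P4, generation 34; `--supports stmt-CriticalPhenomena-4575`).  No definitions, no named facts, no sorries;
standard axioms.  SETTING: `γ, β` finite preorders, `μ, ν` probability weights Sahi-positive of order 2 (positively associated [Sahi2008, §2]),
`a : Fin 4 → γ → [0,1]` monotone, `b : Fin 4 → β → [0,1]` monotone with `b_2 = b_3 = 0` (the new block feeds members 0 and 1 only);
`u_i(x,y) = a_i(x) ⊕ b_i(y) = a_i + b_i − a_ib_i` (so `u_2 = a_2`, `u_3 = a_3`).  HYPOTHESIS `H₄⁺(a)`: Sahi's `E₃ ≥ 0` for the four sub-triples of `a`,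
for the six PRODUCT triples `(a_ia_j, a_k, a_l)`, and `E₄(a) ≥ 0` [Sahi2008, eq. (7); LiebSahi2021, Def. 3.1] — eleven instances of `C₃`/`C₄` on `γ`.
CONCLUSION: the same eleven inequalities for `u` on `γ × β` under `μ ⊗ ν` (`pairBlock_e3_…` ×4, `pairBlock_p3_…` ×6, `pairBlock_e4`), with NO
hypothesis on the pair `(b_0,b_1)` beyond positive association of `ν`.  Since `μ ⊗ ν` is again positively associated on FKG lattices
(`SahiE3UnionTensor.isFKGMeasure_prod`) and `u` is monotone `[0,1]`-valued (`SahiE3UnionTensorGates.monotone_gateSlot`), the step ITERATES: Sahi's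
`E₄ ≥ 0` (indeed all of `H₄⁺`) holds for every quadruple obtained from an `H₄⁺` quadruple (e.g. on ≤ 5 coins, tree `SahiC4CubeFiveAnyIndex`) by
OR-ing in any number of independent positively associated blocks EACH FEEDING AT MOST TWO MEMBERS (relabel members with `sahiE_comp_perm` to
place the pair).  INGREDIENTS: `E₄` — `SahiE4UnionPartial.sahiE_four_orPair_nonneg_of_sahiPositive_two` (five-term identity); product rows —
`SahiE3ProductRowUnion.…orK01/orK02…_of_sahiPositive_two` applied to relabelled families, and generation 32's OR theorem
`SahiE3UnionTensor.sahiE_three_por_nonneg_of_sahiPositive_two` for the pair `{2,3}` and for the sub-triples.  HONEST FRAMING: blocks feeding three or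
four members (conjectures O4, O3P in full) are work in progress; nothing here is Sahi's conjecture itself. [this work]
-/

noncomputable section

namespace Summit.CriticalPhenomena.PercolationContinuityZ3.Theorems.SahiE4UnionPairBlock

open Finset Function Literature.Combinatorics.Sahi2008
open Summit.CriticalPhenomena.PercolationContinuityZ3.Theorems.SahiE3UnionTensor (sahiE_three_por_nonneg_of_sahiPositive_two)
open Summit.CriticalPhenomena.PercolationContinuityZ3.Theorems.SahiE4UnionPartial (sahiE_four_orPair_nonneg_of_sahiPositive_two)
open Summit.CriticalPhenomena.PercolationContinuityZ3.Theorems.SahiE3ProductRowUnion (sahiE_three_prodRow_orK01_nonneg_of_sahiPositive_two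
  sahiE_three_prodRow_orK02_nonneg_of_sahiPositive_two)

variable {α : Type*} [Fintype α]

/-- `E₃` is symmetric in its first two arguments (closed form). [cite: Sahi2008, p. 213] -/
theorem sahiE_three_swap01 (μ : α → ℝ) (f g h : α → ℝ) : sahiE μ 3 ![g, f, h] = sahiE μ 3 ![f, g, h] := by
  rw [sahiE_three, sahiE_three, show g * f * h = f * g * h by ring, show g * f = f * g by ring]; ring

/-- `E₃` is symmetric in its last two arguments (closed form). [cite: Sahi2008, p. 213] -/
theorem sahiE_three_swap12 (μ : α → ℝ) (f g h : α → ℝ) : sahiE μ 3 ![f, h, g] = sahiE μ 3 ![f, g, h] := by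
  rw [sahiE_three, sahiE_three, show f * h * g = f * g * h by ring, show h * g = g * h by ring]; ring

/-- `E₃` vanishes when one member is the zero function (every term has a zero factor). [cite: Sahi2008, p. 213] -/
theorem sahiE_three_zero_left (μ : α → ℝ) (hμ1 : ∑ t, μ t = 1) (g h : α → ℝ) : sahiE μ 3 ![(fun _ => (0:ℝ)), g, h] = 0 := by
  have z1 : ex μ (fun _ => (0:ℝ)) = 0 := ex_const hμ1 0
  have z2 : ex μ ((fun _ => (0:ℝ)) * g * h) = 0 := by
    rw [show ((fun _ => (0:ℝ)) * g * h) = fun _ => (0:ℝ) from funext fun t => by simp]; exact ex_const hμ1 0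
  have z3 : ex μ ((fun _ => (0:ℝ)) * g) = 0 := by
    rw [show ((fun _ => (0:ℝ)) * g) = fun _ => (0:ℝ) from funext fun t => by simp]; exact ex_const hμ1 0
  have z4 : ex μ ((fun _ => (0:ℝ)) * h) = 0 := by
    rw [show ((fun _ => (0:ℝ)) * h) = fun _ => (0:ℝ) from funext fun t => by simp]; exact ex_const hμ1 0
  rw [sahiE_three, z1, z2, z3, z4]; ring

variable {γ β : Type*} [Fintype γ] [Fintype β] [Preorder γ] [Preorder β]
variable (μ : γ → ℝ) (ν : β → ℝ) (hμ0 : ∀ t, 0 ≤ μ t) (hμ1 : ∑ t, μ t = 1) (hν0 : ∀ t, 0 ≤ ν t) (hν1 : ∑ t, ν t = 1)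
  (hμ2 : SahiPositive μ 2) (hν2 : SahiPositive ν 2)
  (a : Fin 4 → γ → ℝ) (b : Fin 4 → β → ℝ) (ha0 : ∀ i t, 0 ≤ a i t) (ha1 : ∀ i t, a i t ≤ 1) (ham : ∀ i, Monotone (a i))
  (hb0 : ∀ i t, 0 ≤ b i t) (hb1 : ∀ i t, b i t ≤ 1) (hbm : ∀ i, Monotone (b i)) (hbz2 : ∀ t, b 2 t = 0) (hbz3 : ∀ t, b 3 t = 0)

/-! ### `E₄` -/

include hμ0 hμ1 hν0 hν1 hμ2 hν2 ha0 ha1 ham hb0 hb1 hbm hbz2 hbz3 in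
/-- **Pair-block step, `E₄`.** [this work] -/
theorem pairBlock_e4 (he123 : 0 ≤ sahiE μ 3 ![a 1, a 2, a 3]) (he023 : 0 ≤ sahiE μ 3 ![a 0, a 2, a 3])
    (hp01 : 0 ≤ sahiE μ 3 ![a 0 * a 1, a 2, a 3]) (he4 : 0 ≤ sahiE μ 4 a) :
    0 ≤ sahiE (fun p : γ × β => μ p.1 * ν p.2) 4 (fun (i : Fin 4) (p : γ × β) => a i p.1 + b i p.2 - a i p.1 * b i p.2) :=
  sahiE_four_orPair_nonneg_of_sahiPositive_two μ ν hμ0 hμ1 hν0 hν1 hμ2 hν2 a b ha0 ha1 ham hb0 hb1 hbm hbz2 hbz3 he123 he023 hp01 he4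

/-! ### `E₃` of the four sub-triples (generation-32 OR theorem; the `b`-triple has a zero member or is a genuine pair) -/

include hμ0 hμ1 hν0 hν1 hμ2 hν2 ha0 ha1 ham hb0 hb1 hbm in
/-- Generic sub-triple step: for an injective choice `i, j, k` of members, `E₃(u_i,u_j,u_k) ≥ 0` from `E₃(a_i,a_j,a_k) ≥ 0` and
`E₃(b_i,b_j,b_k) ≥ 0`. [this work] -/
theorem subTriple (i j k : Fin 4) (hea : 0 ≤ sahiE μ 3 ![a i, a j, a k]) (heb : 0 ≤ sahiE ν 3 ![b i, b j, b k]) :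
    0 ≤ sahiE (fun p : γ × β => μ p.1 * ν p.2) 3
      ![(fun p : γ × β => a i p.1 + b i p.2 - a i p.1 * b i p.2), (fun p : γ × β => a j p.1 + b j p.2 - a j p.1 * b j p.2),
        (fun p : γ × β => a k p.1 + b k p.2 - a k p.1 * b k p.2)] := by
  have h := sahiE_three_por_nonneg_of_sahiPositive_two μ ν hμ0 hμ1 hν0 hν1 hμ2 hν2 ![a i, a j, a k] ![b i, b j, b k]
    (fun m t => by fin_cases m <;> exact ha0 _ t) (fun m t => by fin_cases m <;> exact ha1 _ t) (fun m => by fin_cases m <;> exact ham _)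
    (fun m t => by fin_cases m <;> exact hb0 _ t) (fun m t => by fin_cases m <;> exact hb1 _ t) (fun m => by fin_cases m <;> exact hbm _) hea heb
  rw [show (fun (m : Fin 3) (p : γ × β) => (![a i, a j, a k] : Fin 3 → γ → ℝ) m p.1 + (![b i, b j, b k] : Fin 3 → β → ℝ) m p.2
      - (![a i, a j, a k] : Fin 3 → γ → ℝ) m p.1 * (![b i, b j, b k] : Fin 3 → β → ℝ) m p.2)
      = ![(fun p : γ × β => a i p.1 + b i p.2 - a i p.1 * b i p.2), (fun p : γ × β => a j p.1 + b j p.2 - a j p.1 * b j p.2),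
        (fun p : γ × β => a k p.1 + b k p.2 - a k p.1 * b k p.2)] from funext fun m => by fin_cases m <;> rfl] at h
  exact h

omit [Preorder β] in
include hν1 hbz2 hbz3 in
/-- With `b_2 = b_3 = 0`, every `b`-triple containing member 2 or 3 has `E₃ = 0`. [this work] -/
theorem e3b_zero (i j k : Fin 4) (hk : k = 2 ∨ k = 3) : sahiE ν 3 ![b i, b j, b k] = 0 := by
  have hz : b k = fun _ => (0:ℝ) := by
    rcases hk with rfl | rfl
    · exact funext fun t => hbz2 t
    · exact funext fun t => hbz3 t
  rw [hz, ← sahiE_three_swap12 ν (b i), ← sahiE_three_swap01 ν]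
  exact sahiE_three_zero_left ν hν1 (b i) (b j)

include hμ0 hμ1 hν0 hν1 hμ2 hν2 ha0 ha1 ham hb0 hb1 hbm hbz2 hbz3 in
/-- **Pair-block step, `E₃(u_0,u_1,u_2)`.** [this work] -/
theorem pairBlock_e3_012 (he : 0 ≤ sahiE μ 3 ![a 0, a 1, a 2]) :
    0 ≤ sahiE (fun p : γ × β => μ p.1 * ν p.2) 3
      ![(fun p : γ × β => a 0 p.1 + b 0 p.2 - a 0 p.1 * b 0 p.2), (fun p : γ × β => a 1 p.1 + b 1 p.2 - a 1 p.1 * b 1 p.2),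
        (fun p : γ × β => a 2 p.1 + b 2 p.2 - a 2 p.1 * b 2 p.2)] :=
  subTriple μ ν hμ0 hμ1 hν0 hν1 hμ2 hν2 a b ha0 ha1 ham hb0 hb1 hbm 0 1 2 he (le_of_eq (e3b_zero ν hν1 b hbz2 hbz3 0 1 2 (Or.inl rfl)).symm)

include hμ0 hμ1 hν0 hν1 hμ2 hν2 ha0 ha1 ham hb0 hb1 hbm hbz2 hbz3 in
/-- **Pair-block step, `E₃(u_0,u_1,u_3)`.** [this work] -/
theorem pairBlock_e3_013 (he : 0 ≤ sahiE μ 3 ![a 0, a 1, a 3]) :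
    0 ≤ sahiE (fun p : γ × β => μ p.1 * ν p.2) 3
      ![(fun p : γ × β => a 0 p.1 + b 0 p.2 - a 0 p.1 * b 0 p.2), (fun p : γ × β => a 1 p.1 + b 1 p.2 - a 1 p.1 * b 1 p.2),
        (fun p : γ × β => a 3 p.1 + b 3 p.2 - a 3 p.1 * b 3 p.2)] :=
  subTriple μ ν hμ0 hμ1 hν0 hν1 hμ2 hν2 a b ha0 ha1 ham hb0 hb1 hbm 0 1 3 he (le_of_eq (e3b_zero ν hν1 b hbz2 hbz3 0 1 3 (Or.inr rfl)).symm)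

include hμ0 hμ1 hν0 hν1 hμ2 hν2 ha0 ha1 ham hb0 hb1 hbm hbz2 hbz3 in
/-- **Pair-block step, `E₃(u_0,u_2,u_3)`.** [this work] -/
theorem pairBlock_e3_023 (he : 0 ≤ sahiE μ 3 ![a 0, a 2, a 3]) :
    0 ≤ sahiE (fun p : γ × β => μ p.1 * ν p.2) 3
      ![(fun p : γ × β => a 0 p.1 + b 0 p.2 - a 0 p.1 * b 0 p.2), (fun p : γ × β => a 2 p.1 + b 2 p.2 - a 2 p.1 * b 2 p.2),
        (fun p : γ × β => a 3 p.1 + b 3 p.2 - a 3 p.1 * b 3 p.2)] :=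
  subTriple μ ν hμ0 hμ1 hν0 hν1 hμ2 hν2 a b ha0 ha1 ham hb0 hb1 hbm 0 2 3 he (le_of_eq (e3b_zero ν hν1 b hbz2 hbz3 0 2 3 (Or.inr rfl)).symm)

include hμ0 hμ1 hν0 hν1 hμ2 hν2 ha0 ha1 ham hb0 hb1 hbm hbz2 hbz3 in
/-- **Pair-block step, `E₃(u_1,u_2,u_3)`.** [this work] -/
theorem pairBlock_e3_123 (he : 0 ≤ sahiE μ 3 ![a 1, a 2, a 3]) :
    0 ≤ sahiE (fun p : γ × β => μ p.1 * ν p.2) 3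
      ![(fun p : γ × β => a 1 p.1 + b 1 p.2 - a 1 p.1 * b 1 p.2), (fun p : γ × β => a 2 p.1 + b 2 p.2 - a 2 p.1 * b 2 p.2),
        (fun p : γ × β => a 3 p.1 + b 3 p.2 - a 3 p.1 * b 3 p.2)] :=
  subTriple μ ν hμ0 hμ1 hν0 hν1 hμ2 hν2 a b ha0 ha1 ham hb0 hb1 hbm 1 2 3 he (le_of_eq (e3b_zero ν hν1 b hbz2 hbz3 1 2 3 (Or.inr rfl)).symm)

/-! ### `E₃` of the six product triples -/

omit [Preorder β] in
include hμ1 hν0 hν1 hμ2 ha0 ham hb0 hb1 hbz2 hbz3 in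
/-- **Pair-block step, product row `(u_0u_1, u_2, u_3)`** (rung `K = {0,1}`). [this work] -/
theorem pairBlock_p3_01 (he023 : 0 ≤ sahiE μ 3 ![a 0, a 2, a 3]) (he123 : 0 ≤ sahiE μ 3 ![a 1, a 2, a 3])
    (hp01 : 0 ≤ sahiE μ 3 ![a 0 * a 1, a 2, a 3]) :
    0 ≤ sahiE (fun p : γ × β => μ p.1 * ν p.2) 3
      ![(fun (i : Fin 4) (p : γ × β) => a i p.1 + b i p.2 - a i p.1 * b i p.2) 0 * (fun (i : Fin 4) (p : γ × β) => a i p.1 + b i p.2 - a i p.1 * b i p.2) 1,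
        (fun (i : Fin 4) (p : γ × β) => a i p.1 + b i p.2 - a i p.1 * b i p.2) 2, (fun (i : Fin 4) (p : γ × β) => a i p.1 + b i p.2 - a i p.1 * b i p.2) 3] :=
  sahiE_three_prodRow_orK01_nonneg_of_sahiPositive_two μ ν hμ1 hν0 hν1 hμ2 a b ha0 ham hb0 hb1 hbz2 hbz3 he023 he123 hp01

include hμ0 hμ1 hν0 hν1 hμ2 hν2 ha0 ha1 ham hb0 hb1 hbm hbz2 hbz3 in
/-- Relabelled rung `K = {0,2}`: for members `i, k` (the `b`-carrying member `i ∈ {0,1}` inside the product, `k ∈ {0,1}` the other one as a single) and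
`j, l ∈ {2,3}`: `E₃(u_iu_j, u_k, u_l) ≥ 0` from `E₃(a_j,a_k,a_l) ≥ 0` and the product row `E₃(a_ia_j, a_k, a_l) ≥ 0`. [this work] -/
theorem prodRow_mixed (i j k l : Fin 4) (hj : j = 2 ∨ j = 3) (hl : l = 2 ∨ l = 3)
    (he : 0 ≤ sahiE μ 3 ![a j, a k, a l]) (hp : 0 ≤ sahiE μ 3 ![a i * a j, a k, a l]) :
    0 ≤ sahiE (fun p : γ × β => μ p.1 * ν p.2) 3
      ![(fun p : γ × β => a i p.1 + b i p.2 - a i p.1 * b i p.2) * (fun p : γ × β => a j p.1 + b j p.2 - a j p.1 * b j p.2),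
        (fun p : γ × β => a k p.1 + b k p.2 - a k p.1 * b k p.2), (fun p : γ × β => a l p.1 + b l p.2 - a l p.1 * b l p.2)] := by
  have hzj : ∀ t, (![b i, b j, b k, b l] : Fin 4 → β → ℝ) 1 t = 0 := fun t => by
    rcases hj with rfl | rfl
    · exact hbz2 t
    · exact hbz3 t
  have hzl : ∀ t, (![b i, b j, b k, b l] : Fin 4 → β → ℝ) 3 t = 0 := fun t => by
    rcases hl with rfl | rfl
    · exact hbz2 t
    · exact hbz3 t
  have h := sahiE_three_prodRow_orK02_nonneg_of_sahiPositive_two μ ν hμ0 hμ1 hν0 hν1 hμ2 hν2 ![a i, a j, a k, a l] ![b i, b j, b k, b l]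
    (fun m t => by fin_cases m <;> exact ha0 _ t) (fun m t => by fin_cases m <;> exact ha1 _ t) (fun m => by fin_cases m <;> exact ham _)
    (fun m t => by fin_cases m <;> exact hb0 _ t) (fun m t => by fin_cases m <;> exact hb1 _ t) (fun m => by fin_cases m <;> exact hbm _)
    hzj hzl he hp
  exact h

include hμ0 hμ1 hν0 hν1 hμ2 hν2 ha0 ha1 ham hb0 hb1 hbm hbz2 hbz3 in
/-- **Pair-block step, product row `(u_0u_2, u_1, u_3)`.** [this work] -/
theorem pairBlock_p3_02 (he213 : 0 ≤ sahiE μ 3 ![a 2, a 1, a 3]) (hp02 : 0 ≤ sahiE μ 3 ![a 0 * a 2, a 1, a 3]) :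
    0 ≤ sahiE (fun p : γ × β => μ p.1 * ν p.2) 3
      ![(fun p : γ × β => a 0 p.1 + b 0 p.2 - a 0 p.1 * b 0 p.2) * (fun p : γ × β => a 2 p.1 + b 2 p.2 - a 2 p.1 * b 2 p.2),
        (fun p : γ × β => a 1 p.1 + b 1 p.2 - a 1 p.1 * b 1 p.2), (fun p : γ × β => a 3 p.1 + b 3 p.2 - a 3 p.1 * b 3 p.2)] :=
  prodRow_mixed μ ν hμ0 hμ1 hν0 hν1 hμ2 hν2 a b ha0 ha1 ham hb0 hb1 hbm hbz2 hbz3 0 2 1 3 (Or.inl rfl) (Or.inr rfl) he213 hp02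

include hμ0 hμ1 hν0 hν1 hμ2 hν2 ha0 ha1 ham hb0 hb1 hbm hbz2 hbz3 in
/-- **Pair-block step, product row `(u_0u_3, u_1, u_2)`.** [this work] -/
theorem pairBlock_p3_03 (he312 : 0 ≤ sahiE μ 3 ![a 3, a 1, a 2]) (hp03 : 0 ≤ sahiE μ 3 ![a 0 * a 3, a 1, a 2]) :
    0 ≤ sahiE (fun p : γ × β => μ p.1 * ν p.2) 3
      ![(fun p : γ × β => a 0 p.1 + b 0 p.2 - a 0 p.1 * b 0 p.2) * (fun p : γ × β => a 3 p.1 + b 3 p.2 - a 3 p.1 * b 3 p.2),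
        (fun p : γ × β => a 1 p.1 + b 1 p.2 - a 1 p.1 * b 1 p.2), (fun p : γ × β => a 2 p.1 + b 2 p.2 - a 2 p.1 * b 2 p.2)] :=
  prodRow_mixed μ ν hμ0 hμ1 hν0 hν1 hμ2 hν2 a b ha0 ha1 ham hb0 hb1 hbm hbz2 hbz3 0 3 1 2 (Or.inr rfl) (Or.inl rfl) he312 hp03

include hμ0 hμ1 hν0 hν1 hμ2 hν2 ha0 ha1 ham hb0 hb1 hbm hbz2 hbz3 in
/-- **Pair-block step, product row `(u_1u_2, u_0, u_3)`.** [this work] -/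
theorem pairBlock_p3_12 (he203 : 0 ≤ sahiE μ 3 ![a 2, a 0, a 3]) (hp12 : 0 ≤ sahiE μ 3 ![a 1 * a 2, a 0, a 3]) :
    0 ≤ sahiE (fun p : γ × β => μ p.1 * ν p.2) 3
      ![(fun p : γ × β => a 1 p.1 + b 1 p.2 - a 1 p.1 * b 1 p.2) * (fun p : γ × β => a 2 p.1 + b 2 p.2 - a 2 p.1 * b 2 p.2),
        (fun p : γ × β => a 0 p.1 + b 0 p.2 - a 0 p.1 * b 0 p.2), (fun p : γ × β => a 3 p.1 + b 3 p.2 - a 3 p.1 * b 3 p.2)] :=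
  prodRow_mixed μ ν hμ0 hμ1 hν0 hν1 hμ2 hν2 a b ha0 ha1 ham hb0 hb1 hbm hbz2 hbz3 1 2 0 3 (Or.inl rfl) (Or.inr rfl) he203 hp12

include hμ0 hμ1 hν0 hν1 hμ2 hν2 ha0 ha1 ham hb0 hb1 hbm hbz2 hbz3 in
/-- **Pair-block step, product row `(u_1u_3, u_0, u_2)`.** [this work] -/
theorem pairBlock_p3_13 (he302 : 0 ≤ sahiE μ 3 ![a 3, a 0, a 2]) (hp13 : 0 ≤ sahiE μ 3 ![a 1 * a 3, a 0, a 2]) :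
    0 ≤ sahiE (fun p : γ × β => μ p.1 * ν p.2) 3
      ![(fun p : γ × β => a 1 p.1 + b 1 p.2 - a 1 p.1 * b 1 p.2) * (fun p : γ × β => a 3 p.1 + b 3 p.2 - a 3 p.1 * b 3 p.2),
        (fun p : γ × β => a 0 p.1 + b 0 p.2 - a 0 p.1 * b 0 p.2), (fun p : γ × β => a 2 p.1 + b 2 p.2 - a 2 p.1 * b 2 p.2)] :=
  prodRow_mixed μ ν hμ0 hμ1 hν0 hν1 hμ2 hν2 a b ha0 ha1 ham hb0 hb1 hbm hbz2 hbz3 1 3 0 2 (Or.inr rfl) (Or.inl rfl) he302 hp13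

include hμ0 hμ1 hν0 hν1 hμ2 hν2 ha0 ha1 ham hb0 hb1 hbm hbz2 hbz3 in
/-- **Pair-block step, product row `(u_2u_3, u_0, u_1)`** (the product member carries no `b`: generation-32 OR theorem for the triples
`(a_2a_3, a_0, a_1)` and `(0, b_0, b_1)`). [this work] -/
theorem pairBlock_p3_23 (hp23 : 0 ≤ sahiE μ 3 ![a 2 * a 3, a 0, a 1]) :
    0 ≤ sahiE (fun p : γ × β => μ p.1 * ν p.2) 3
      ![(fun p : γ × β => a 2 p.1 + b 2 p.2 - a 2 p.1 * b 2 p.2) * (fun p : γ × β => a 3 p.1 + b 3 p.2 - a 3 p.1 * b 3 p.2),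
        (fun p : γ × β => a 0 p.1 + b 0 p.2 - a 0 p.1 * b 0 p.2), (fun p : γ × β => a 1 p.1 + b 1 p.2 - a 1 p.1 * b 1 p.2)] := by
  have h23m : Monotone (a 2 * a 3) := (ham 2).mul (ham 3) (ha0 2) (ha0 3)
  have h := sahiE_three_por_nonneg_of_sahiPositive_two μ ν hμ0 hμ1 hν0 hν1 hμ2 hν2 ![a 2 * a 3, a 0, a 1] ![(fun _ => (0:ℝ)), b 0, b 1]
    (fun m t => by fin_cases m <;> [exact mul_nonneg (ha0 2 t) (ha0 3 t); exact ha0 0 t; exact ha0 1 t])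
    (fun m t => by fin_cases m <;> [exact mul_le_one₀ (ha1 2 t) (ha0 3 t) (ha1 3 t); exact ha1 0 t; exact ha1 1 t])
    (fun m => by fin_cases m <;> [exact h23m; exact ham 0; exact ham 1])
    (fun m t => by fin_cases m <;> [exact le_rfl; exact hb0 0 t; exact hb0 1 t])
    (fun m t => by fin_cases m <;> [exact zero_le_one; exact hb1 0 t; exact hb1 1 t])
    (fun m => by fin_cases m <;> [exact monotone_const; exact hbm 0; exact hbm 1])
    hp23 (le_of_eq (sahiE_three_zero_left ν hν1 (b 0) (b 1)).symm)
  rw [show (fun (m : Fin 3) (p : γ × β) => (![a 2 * a 3, a 0, a 1] : Fin 3 → γ → ℝ) m p.1 + (![(fun _ => (0:ℝ)), b 0, b 1] : Fin 3 → β → ℝ) m p.2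
      - (![a 2 * a 3, a 0, a 1] : Fin 3 → γ → ℝ) m p.1 * (![(fun _ => (0:ℝ)), b 0, b 1] : Fin 3 → β → ℝ) m p.2)
      = ![(fun p : γ × β => a 2 p.1 + b 2 p.2 - a 2 p.1 * b 2 p.2) * (fun p : γ × β => a 3 p.1 + b 3 p.2 - a 3 p.1 * b 3 p.2),
        (fun p : γ × β => a 0 p.1 + b 0 p.2 - a 0 p.1 * b 0 p.2), (fun p : γ × β => a 1 p.1 + b 1 p.2 - a 1 p.1 * b 1 p.2)] from
      funext fun m => by
        fin_cases m
        · funext p; simp [hbz2 p.2, hbz3 p.2]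
        · rfl
        · rfl] at h
  exact h

end Summit.CriticalPhenomena.PercolationContinuityZ3.Theorems.SahiE4UnionPairBlock

end
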